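import Mathlib.LinearAlgebra.Complex.FiniteDimensional
import Mathlib.LinearAlgebra.Dimension.Constructions
import Literature.NumberTheory.Transcendental.ComplexDeRhamRealStructure
import Literature.Geometry.Kaehler.DeRhamFinite
import Literature.AlgebraicTopology.SingularHomology.BettiNumberBaseChange
import HarnessLib

/-!
# Finite-dimensionality of complex de Rham cohomology; `dim_ℂ H^k_dR(M; ℂ) = dim_ℝ H^k_dR(M; ℝ)`

Trunk **T-KAEHLER** (`NumberTheory/Transcendental`). Companion to `ComplexDeRhamRealStructure`
(the real structure `H^k_dR(M; ℂ) = H^k_dR(M; ℝ) ⊗ ℂ` of C9's complex de Rham cohomology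
`complexDeRhamCohomology E M k`: real and imaginary parts `re`, `im` and complexification `ofReal`
of classes, all PROVED there) and to G21's `Geometry/Kaehler/DeRhamFinite`
(`moduleFinite_deRhamCohomology_of_compactSpace`: the real de Rham cohomology
`deRhamCohomology I M F k` of a compact manifold is finite-dimensional, PROVED there by
Mayer–Vietoris and the Poincaré lemma in charts, Bott–Tu (1982), Prop. 5.3.1). PROVED here, with
no named fact consumed:

* `complexDeRhamCohomology.reProdIm_bijective` (`nonempty_linearEquiv_prod`): the `ℝ`-linear
  map `c ↦ (re c, im c)`, `H^k_dR(M; ℂ) → H^k_dR(M; ℝ) × H^k_dR(M; ℝ)`, is bijective (inverse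
  `(a, b) ↦ a ⊗ 1 + i • b ⊗ 1`) — the sentence "`H^k(X, ℂ) = H^k(X, ℝ) ⊗ ℂ`" of Voisin (2002),
  §6.1.3, Cor. 6.12 (for de Rham cohomology; cf. §5.3.1, proof of Thm. 5.23) as an isomorphism of
  real vector spaces; everything in this file is a theorem (no definitions, no named facts);
* `complexDeRhamCohomology.finrank_eq_finrank_deRhamCohomology`:
  **`dim_ℂ H^k_dR(M; ℂ) = dim_ℝ H^k_dR(M; ℝ)`** for every manifold (both sides are `0` when the
  cohomology is infinite-dimensional), and `Module.Finite ℝ H^k_dR(M; ℝ) ↔ Module.Finite ℂ H^k_dR(M; ℂ)`;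
* `complexDeRhamCohomology.finite_of_compactSpace`: **for a compact Hausdorff manifold charted on
  a finite-dimensional complex normed space, `H^k_dR(M; ℂ)` is a finite-dimensional complex vector
  space** (Voisin (2002), §5.3.1, Cor. 5.25 / Thm. 5.23 prove this via harmonic forms; here it is
  metric-free, from G21's Mayer–Vietoris finiteness of `H^k_dR(M; ℝ)`);
* `finrank_complexDeRham_eq_bettiNumber_iff_real`: the two named facts
  `finrank_complexDeRham_eq_bettiNumber E M k` (`dim_ℂ H^k_dR(M; ℂ) = b_k(M; ℂ)`) and
  `finrank_deRhamCohomology_eq_bettiNumber 𝓘(ℝ, E) M k` (`dim_ℝ H^k_dR(M; ℝ) = b_k(M; ℝ)`) of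
  `DeRhamTheorem` are EQUIVALENT, by the above and `b_k(M; ℝ) = b_k(M; ℂ)`
  (`bettiNumber_real_eq_complex`, universal coefficients over a field extension, PROVED in
  `AlgebraicTopology/SingularHomology/BettiNumberBaseChange`); in particular the complex fact is
  no longer an independent leaf of the trust base.

Mathlib (pinned v4.32.0) has no de Rham cohomology; used: `finrank_real_of_complex`
(`dim_ℝ V = 2 dim_ℂ V`), `Module.finrank_prod`, `Module.Finite.of_restrictScalars_finite`,
`Module.finrank_of_not_finite`.

## References

* C. Voisin, *Hodge Theory and Complex Algebraic Geometry I* (2002), §5.3.1 (Thm. 5.23,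
  Cor. 5.25), §6.1.3 Cor. 6.12 (`VoisinHodgeI2002`).
* R. Bott, L. W. Tu, *Differential Forms in Algebraic Topology* (1982), Prop. 5.3.1
  (`BottTu1982Forms`).
* A. Hatcher, *Algebraic Topology* (2002), §3.A, Thm. 3A.3 (`HatcherAT2002`).
-/

noncomputable section

open scoped Manifold ContDiff
open Module

namespace Literature.NumberTheory.Transcendental

namespace complexDeRhamCohomology

open Literature.Geometry.Kaehler (deRhamCohomology)

variable {E : Type*} [NormedAddCommGroup E] [NormedSpace ℂ E]
  {M : Type*} [TopologicalSpace M] [ChartedSpace E M] {k : ℕ}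

/-! ### `H^k_dR(M; ℂ) = H^k_dR(M; ℝ) ⊕ i H^k_dR(M; ℝ)` as real vector spaces -/

/-- `c ↦ (re c, im c)` is injective: a complex class is determined by its real and imaginary
parts (`ext_re_im`). [cite: VoisinHodgeI2002, §6.1.3 Cor. 6.12] -/
theorem reProdIm_injective : Function.Injective ((re E M k).prod (im E M k)) :=
  fun _ _ h ↦ ext_re_im (congrArg Prod.fst h) (congrArg Prod.snd h)

/-- `c ↦ (re c, im c)` is surjective: `(a, b)` is hit by `a ⊗ 1 + i • b ⊗ 1`.
[cite: VoisinHodgeI2002, §6.1.3 Cor. 6.12] -/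
theorem reProdIm_surjective : Function.Surjective ((re E M k).prod (im E M k)) := by
  rintro ⟨a, b⟩
  refine ⟨ofReal E M k a + Complex.I • ofReal E M k b, Prod.ext ?_ ?_⟩
  · change re E M k (ofReal E M k a + Complex.I • ofReal E M k b) = a
    rw [map_add, re_ofReal, re_I_smul, im_ofReal, neg_zero, add_zero]
  · change im E M k (ofReal E M k a + Complex.I • ofReal E M k b) = b
    rw [map_add, im_ofReal, im_I_smul, re_ofReal, zero_add]

/-- **`H^k_dR(M; ℂ) ≅ H^k_dR(M; ℝ) × H^k_dR(M; ℝ)` over `ℝ`, by `c ↦ (re c, im c)`** (bijective,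
inverse `(a, b) ↦ a ⊗ 1 + i • b ⊗ 1`): complex de Rham cohomology is the complexification of real
de Rham cohomology ("`H^k(X, ℂ) = H^k(X, ℝ) ⊗ ℂ`", Voisin (2002), §6.1.3 Cor. 6.12; for de Rham
cohomology this is `d` being a real operator, §5.3.1). [cite: VoisinHodgeI2002, §6.1.3 Cor. 6.12] -/
theorem reProdIm_bijective : Function.Bijective ((re E M k).prod (im E M k)) :=
  ⟨reProdIm_injective, reProdIm_surjective⟩

/-- `H^k_dR(M; ℂ) ≃ₗ[ℝ] H^k_dR(M; ℝ) × H^k_dR(M; ℝ)` (existence of the `ℝ`-linear isomorphism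
`c ↦ (re c, im c)`; use `LinearEquiv.ofBijective _ reProdIm_bijective` for the map itself).
[cite: VoisinHodgeI2002, §6.1.3 Cor. 6.12] -/
theorem nonempty_linearEquiv_prod :
    Nonempty (complexDeRhamCohomology E M k ≃ₗ[ℝ]
      deRhamCohomology 𝓘(ℝ, E) M ℝ k × deRhamCohomology 𝓘(ℝ, E) M ℝ k) :=
  ⟨LinearEquiv.ofBijective _ reProdIm_bijective⟩

/-! ### Finiteness and dimension -/

/-- `H^k_dR(M; ℂ)` is finite-dimensional over `ℝ` as soon as `H^k_dR(M; ℝ)` is. [folklore] -/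
theorem finite_real_of_finite [Module.Finite ℝ (deRhamCohomology 𝓘(ℝ, E) M ℝ k)] :
    Module.Finite ℝ (complexDeRhamCohomology E M k) :=
  Module.Finite.equiv (LinearEquiv.ofBijective _ reProdIm_bijective).symm

/-- **`H^k_dR(M; ℂ)` is a finite-dimensional complex vector space as soon as `H^k_dR(M; ℝ)` is a
finite-dimensional real one** (`H^k_dR(M; ℂ) = H^k_dR(M; ℝ) ⊗ ℂ`).
[cite: VoisinHodgeI2002, §6.1.3 Cor. 6.12] -/
theorem finite_of_finite [Module.Finite ℝ (deRhamCohomology 𝓘(ℝ, E) M ℝ k)] :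
    Module.Finite ℂ (complexDeRhamCohomology E M k) :=
  haveI := finite_real_of_finite (E := E) (M := M) (k := k)
  Module.Finite.of_restrictScalars_finite ℝ ℂ (complexDeRhamCohomology E M k)

/-- Conversely `H^k_dR(M; ℝ)`, a real direct factor of `H^k_dR(M; ℂ)`, is finite-dimensional when
`H^k_dR(M; ℂ)` is. [folklore] -/
theorem finite_deRhamCohomology_of_finite [Module.Finite ℂ (complexDeRhamCohomology E M k)] :
    Module.Finite ℝ (deRhamCohomology 𝓘(ℝ, E) M ℝ k) := by
  haveI : Module.Finite ℝ (complexDeRhamCohomology E M k) := Module.Finite.trans ℂ _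
  exact Module.Finite.of_surjective (re E M k) fun a ↦ ⟨ofReal E M k a, re_ofReal a⟩

/-- `H^k_dR(M; ℝ)` is finite-dimensional over `ℝ` iff `H^k_dR(M; ℂ)` is finite-dimensional over
`ℂ`. [cite: VoisinHodgeI2002, §6.1.3 Cor. 6.12] -/
theorem finite_deRhamCohomology_iff_finite :
    Module.Finite ℝ (deRhamCohomology 𝓘(ℝ, E) M ℝ k) ↔ Module.Finite ℂ (complexDeRhamCohomology E M k) :=
  ⟨fun _ ↦ finite_of_finite, fun _ ↦ finite_deRhamCohomology_of_finite⟩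

/-- `dim_ℝ H^k_dR(M; ℂ) = 2 · dim_ℝ H^k_dR(M; ℝ)` (both sides `0` in the infinite-dimensional
case). [cite: VoisinHodgeI2002, §6.1.3 Cor. 6.12] -/
theorem finrank_real_eq_two_mul :
    finrank ℝ (complexDeRhamCohomology E M k) = 2 * finrank ℝ (deRhamCohomology 𝓘(ℝ, E) M ℝ k) := by
  rw [(LinearEquiv.ofBijective _ reProdIm_bijective).finrank_eq]
  by_cases h : Module.Finite ℝ (deRhamCohomology 𝓘(ℝ, E) M ℝ k)
  · rw [Module.finrank_prod, two_mul]
  · have h2 : ¬Module.Finite ℝ (deRhamCohomology 𝓘(ℝ, E) M ℝ k × deRhamCohomology 𝓘(ℝ, E) M ℝ k) := by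
      intro h'
      exact h (Module.Finite.of_surjective
        (LinearMap.fst ℝ (deRhamCohomology 𝓘(ℝ, E) M ℝ k) (deRhamCohomology 𝓘(ℝ, E) M ℝ k))
        Prod.fst_surjective)
    rw [Module.finrank_of_not_finite h, Module.finrank_of_not_finite h2, mul_zero]

/-- **`dim_ℂ H^k_dR(M; ℂ) = dim_ℝ H^k_dR(M; ℝ)`** for every manifold charted on a complex normed
space (`H^k_dR(M; ℂ) = H^k_dR(M; ℝ) ⊗ ℂ`; both sides are `0` when the cohomology is
infinite-dimensional). Voisin (2002), §6.1.3 Cor. 6.12 and §5.3.1.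
[cite: VoisinHodgeI2002, §6.1.3 Cor. 6.12] -/
theorem finrank_eq_finrank_deRhamCohomology :
    finrank ℂ (complexDeRhamCohomology E M k) = finrank ℝ (deRhamCohomology 𝓘(ℝ, E) M ℝ k) := by
  have h := finrank_real_of_complex (complexDeRhamCohomology E M k)
  rw [finrank_real_eq_two_mul] at h
  omega

/-! ### Compact manifolds -/

section Compact

variable [FiniteDimensional ℂ E] [IsManifold 𝓘(ℝ, E) ∞ M] [T2Space M] [CompactSpace M]

variable (E M) in
/-- **The complex de Rham cohomology of a compact manifold is finite-dimensional**: for a compact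
Hausdorff `C^∞` manifold `M` charted on a finite-dimensional complex normed space `E`,
`H^k_dR(M; ℂ)` is a finite-dimensional `ℂ`-vector space, for every `k`. Voisin (2002), §5.3.1
(Thm. 5.23 / Cor. 5.25, via harmonic forms); here metric-free: `H^k_dR(M; ℂ) = H^k_dR(M; ℝ) ⊗ ℂ`
and G21's Mayer–Vietoris finiteness `moduleFinite_deRhamCohomology_of_compactSpace`
(Bott–Tu (1982), Prop. 5.3.1). PROVED; no named fact is consumed.
[cite: VoisinHodgeI2002, §5.3.1 Thm. 5.23] [cite: BottTu1982Forms, Prop. 5.3.1] -/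
theorem finite_of_compactSpace (k : ℕ) : Module.Finite ℂ (complexDeRhamCohomology E M k) :=
  haveI := Literature.Geometry.Kaehler.moduleFinite_deRhamCohomology_of_compactSpace 𝓘(ℝ, E) M ℝ k
  finite_of_finite

variable (E M) in
/-- Real form: `H^k_dR(M; ℂ)` of a compact manifold is finite-dimensional over `ℝ` as well.
[cite: BottTu1982Forms, Prop. 5.3.1] -/
theorem finite_real_of_compactSpace (k : ℕ) : Module.Finite ℝ (complexDeRhamCohomology E M k) :=
  haveI := Literature.Geometry.Kaehler.moduleFinite_deRhamCohomology_of_compactSpace 𝓘(ℝ, E) M ℝ k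
  finite_real_of_finite

end Compact

end complexDeRhamCohomology

/-! ### The two Betti-number facts of `DeRhamTheorem` are equivalent -/

section Betti

variable (E : Type*) [NormedAddCommGroup E] [NormedSpace ℂ E] [FiniteDimensional ℂ E]
  (M : Type*) [TopologicalSpace M] [ChartedSpace E M] [IsManifold 𝓘(ℝ, E) ∞ M] [T2Space M]
  [CompactSpace M] (k : ℕ)

/-- **`dim_ℂ H^k_dR(M; ℂ) = b_k(M; ℂ)` iff `dim_ℝ H^k_dR(M; ℝ) = b_k(M; ℝ)`**: the named facts
`finrank_complexDeRham_eq_bettiNumber E M k` and `finrank_deRhamCohomology_eq_bettiNumber 𝓘(ℝ, E) M k`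
of `DeRhamTheorem` are equivalent, since `dim_ℂ H^k_dR(M; ℂ) = dim_ℝ H^k_dR(M; ℝ)`
(`complexDeRhamCohomology.finrank_eq_finrank_deRhamCohomology`) and `b_k(M; ℝ) = b_k(M; ℂ)`
(`bettiNumber_real_eq_complex`, universal coefficients, Hatcher (2002), Thm. 3A.3). Voisin (2002),
§6.1.3 Cor. 6.12 ("`H^k(X, ℂ) = H^k(X, ℝ) ⊗ ℂ`"). [cite: VoisinHodgeI2002, §6.1.3 Cor. 6.12]
[cite: HatcherAT2002, §3.A Thm. 3A.3] -/
theorem finrank_complexDeRham_eq_bettiNumber_iff_real :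
    finrank_complexDeRham_eq_bettiNumber E M k ↔ finrank_deRhamCohomology_eq_bettiNumber 𝓘(ℝ, E) M k := by
  unfold finrank_complexDeRham_eq_bettiNumber finrank_deRhamCohomology_eq_bettiNumber
  rw [complexDeRhamCohomology.finrank_eq_finrank_deRhamCohomology,
    Literature.AlgebraicTopology.SingularHomology.bettiNumber_real_eq_complex M k]

/-- **The complex Betti-number fact from the real one**:
`finrank_deRhamCohomology_eq_bettiNumber 𝓘(ℝ, E) M k → finrank_complexDeRham_eq_bettiNumber E M k`
(so de Rham's theorem with real coefficients discharges the complex statement used by Hodge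
theory). [cite: VoisinHodgeI2002, §6.1.3 Cor. 6.12] -/
theorem finrank_complexDeRham_eq_bettiNumber_of_real
    (h : finrank_deRhamCohomology_eq_bettiNumber 𝓘(ℝ, E) M k) :
    finrank_complexDeRham_eq_bettiNumber E M k :=
  (finrank_complexDeRham_eq_bettiNumber_iff_real E M k).2 h

/-- **The real Betti-number fact from the complex one.** [cite: VoisinHodgeI2002, §6.1.3 Cor. 6.12] -/
theorem finrank_deRhamCohomology_eq_bettiNumber_of_complex
    (h : finrank_complexDeRham_eq_bettiNumber E M k) :
    finrank_deRhamCohomology_eq_bettiNumber 𝓘(ℝ, E) M k :=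
  (finrank_complexDeRham_eq_bettiNumber_iff_real E M k).1 h

end Betti

end Literature.NumberTheory.Transcendental
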